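import Literature.Probability.Percolation.ComplementPatternCounts
import HarnessLib

/-!
# The punctured open cluster of the port and the far flip `ι₀` — DEFINITIONS

Crux `stmt-CriticalPhenomena-4575`, route `PercNearOneGluingNoHeavy`, 3-point CPI₂ fibre line (facecert gen 27; memo
`prim-l12/prim-facecert/FINDING-gen27-PUNCTURED-INVOLUTION.md`).  Objects posited by the proof of the one-sided part of the
one-colour inequality `(★★)` of `…ThreePointCPIReimer` (the theorems are in `…ThreePointCPIPunctured` and
`…ThreePointCPIPuncturedCount`).  For a finite multigraph `(V, α, ends)`, terminals `s, b`, port `c` and a configuration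
`z : α → Bool` (vocabulary of `Literature/Probability/Percolation/ComplementPatternCounts.lean`):

* `punct ends s b z` — the open edges of `z` avoiding both terminals (the open graph of `z` with `s, b` isolated);
* `PReach ends s b c z v` — `v` lies in the PUNCTURED OPEN CLUSTER `R(z)` of `c` (an open path `c → v` avoiding `s, b`);
* `Touch ends s b c z a` — the label `a` has an endpoint in `R(z)`;
* `farFlip ends s b c z` — the FAR FLIP `ι₀(z)`: complement every label not touching `R(z)`; an involution of the cube
  preserving `R` (`…ThreePointCPIPunctured.farFlip_farFlip`);
* `PortOpen ends s b c z t` — `R(z)` is open-adjacent to the terminal `t`; `OneSided ends s b c z` — not open-adjacent to both.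

Definitions only (no theorems, no named facts). [this work]
-/

namespace Summit.CriticalPhenomena.PercolationContinuityZ3.Theorems.ThreePointCPIPunctured

open Literature.Probability.Percolation

variable {V α : Type*}

/-- The **punctured open configuration**: the open edges of `z` (images of open labels) that avoid
both terminals `s` and `b`. Its open graph `openGraph (punct ends s b z)` is the open graph of `z` with
the two terminals isolated. [this work] -/
def punct (ends : α → Sym2 V) (s b : V) (z : α → Bool) : BondConfig V :=
  {e | e ∈ labelledOpen ends z ∧ s ∉ e ∧ b ∉ e}

/-- `PReach ends s b c z v`: `v` lies in the **punctured open cluster** `R(z)` of the port `c`, i.e. `c`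
is joined to `v` by an open path of `z` avoiding `s` and `b`. [this work] -/
def PReach (ends : α → Sym2 V) (s b c : V) (z : α → Bool) (v : V) : Prop :=
  (openGraph (punct ends s b z)).Reachable c v

/-- A label **touches** the punctured cluster `R(z)` when one of its endpoints lies in it. [this work] -/
def Touch (ends : α → Sym2 V) (s b c : V) (z : α → Bool) (a : α) : Prop :=
  ∃ v, v ∈ ends a ∧ PReach ends s b c z v

open Classical in
/-- The **far flip** `ι₀(z)`: complement every label with no endpoint in the punctured open cluster
`R(z)` of `c`, keep the labels touching `R(z)`. It is an involution of the cube
(`farFlip_farFlip`). [this work] -/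
noncomputable def farFlip (ends : α → Sym2 V) (s b c : V) (z : α → Bool) : α → Bool :=
  fun a => if Touch ends s b c z a then z a else !z a

/-- `PortOpen ends s b c z t`: the punctured cluster `R(z)` is **open-adjacent** to the terminal `t`:
some open label of `z` contains `t` and touches `R(z)`. [this work] -/
def PortOpen (ends : α → Sym2 V) (s b c : V) (z : α → Bool) (t : V) : Prop :=
  ∃ a, z a = true ∧ t ∈ ends a ∧ Touch ends s b c z a

/-- `OneSided ends s b c z`: the punctured open cluster of `c` is NOT open-adjacent to both
terminals. [this work] -/
def OneSided (ends : α → Sym2 V) (s b c : V) (z : α → Bool) : Prop :=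
  ¬ (PortOpen ends s b c z s ∧ PortOpen ends s b c z b)

end Summit.CriticalPhenomena.PercolationContinuityZ3.Theorems.ThreePointCPIPunctured
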